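import Mathlib.Algebra.Module.ZLattice.Basic
import Mathlib.Analysis.Complex.OperatorNorm
import Mathlib.Analysis.Complex.ReImTopology
import Mathlib.Analysis.InnerProductSpace.PiL2
import Mathlib.Geometry.Manifold.IsManifold.Basic
import Mathlib.Geometry.Manifold.Riemannian.Basic
import Mathlib.LinearAlgebra.Complex.Orientation
import Mathlib.Topology.Algebra.Order.Archimedean
import Mathlib.Topology.Covering.Quotient
import Mathlib.Topology.Instances.Irrational
import Literature.Geometry.Kaehler.Kaehler
import Literature.Geometry.Kaehler.ManifoldFormsChart
import Literature.Geometry.Kaehler.RiemannianHodge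
import HarnessLib

/-!
# The twisted torus: a compact `C^∞` (indeed `Cω`) real surface charted on `ℂ` by holomorphic
# and anti-holomorphic charts interleaved on a dense set

This file builds the test manifold used to refute, as elaborated, the named facts of
`Literature/NumberTheory/Transcendental/KaehlerHodge.lean` whose `def … : Prop` dropped the
holomorphic-atlas instance `[IsManifold 𝓘(ℂ, E) ω M]` of their section (an M5 rewrite defect;
see `KaehlerHodgeComplexAtlasFact.lean`).

* `TwistedTorus.gaussLattice = ℤ ⊕ ℤi ⊂ ℂ` (Mathlib's `ZSpan` of `Complex.basisOneI`; discrete),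
  `TwistedTorus = ℂ ⧸ ℤ[i]` (a type synonym of the quotient group, so that no instance is put on
  a Mathlib type), the projection `TwistedTorus.proj`, which is a covering map
  (`AddSubgroup.isAddQuotientCoveringMap_of_comm`); `TwistedTorus` is compact Hausdorff.
* `TwistedTorus.cov z`: a local homeomorphism `ℂ → TwistedTorus` agreeing with `proj` and
  defined near `z`; `TwistedTorus.sChart x = (cov (lift x)).symm`, the *straight* chart at `x`
  (a local inverse of `proj`). Two straight charts differ, near every point, by a lattice
  translation (`TwistedTorus.sChart_proj_eventuallyEq_add`, `TwistedTorus.transition_eventuallyEq`).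
* The **twist**: `TwistedTorus.D = proj {Re z ∈ ℚ}` (dense, with dense complement) and
  `TwistedTorus.twist x : ℂ ≃L[ℝ] ℂ`, the identity for `x ∈ D` and complex conjugation for
  `x ∉ D`. The charted-space structure `chartAt x = (sChart x).transHomeomorph (twist x)` has
  transition maps that are, locally, `y ↦ σ' (σ⁻¹ y + c)` with `σ, σ' ∈ {id, conj}` and
  `c ∈ ℤ[i]`; hence `TwistedTorus` is a `C^n` real manifold over `𝓘(ℝ, ℂ)` for every `n`
  (`TwistedTorus.instIsManifold`), but of course *not* a complex manifold: the "complex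
  structure" `i •` of `TangentSpace 𝓘(ℝ, ℂ) x = ℂ` read through `chartAt x` is `+i` on `D`
  and `-i` off `D`.

Everything here is elementary topology of the square torus; no differential-geometric fact of
the literature is involved. [folklore]

## References

* C. Voisin, *Hodge Theory and Complex Algebraic Geometry I* (2002), §2.1 (complex manifolds are
  the charted spaces with *holomorphic* transition maps — the hypothesis whose omission this
  construction exploits).
-/

noncomputable section

open scoped Manifold ContDiff Topology ComplexConjugate
open Set Module Function Bundle

attribute [local instance] Complex.finrank_real_complex_fact

namespace Literature.NumberTheory.Transcendental

/-! ### The Gaussian lattice and the torus -/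

namespace TwistedTorus

/-- The Gaussian integers `ℤ ⊕ ℤi ⊂ ℂ` as the `ℤ`-span of the real basis `(1, i)` (Mathlib's
`ZSpan` setting, which supplies discreteness). [folklore] -/
abbrev gaussLattice : Submodule ℤ ℂ := Submodule.span ℤ (Set.range Complex.basisOneI)

/-- Membership in the Gaussian lattice: `z = m + n i` with `m n : ℤ`. [folklore] -/
theorem mem_gaussLattice_iff {z : ℂ} : z ∈ gaussLattice ↔ ∃ m n : ℤ, z = m + n * Complex.I := by
  rw [Submodule.mem_span_range_iff_exists_fun]
  constructor
  · rintro ⟨c, rfl⟩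
    exact ⟨c 0, c 1, by simp [Fin.sum_univ_two, Complex.coe_basisOneI, zsmul_eq_mul]⟩
  · rintro ⟨m, n, rfl⟩
    exact ⟨![m, n], by simp [Fin.sum_univ_two, Complex.coe_basisOneI, zsmul_eq_mul]⟩

/-- The real part of a Gaussian integer is an integer. [folklore] -/
theorem exists_re_eq_intCast_of_mem_gaussLattice {z : ℂ} (hz : z ∈ gaussLattice) :
    ∃ m : ℤ, z.re = m := by
  obtain ⟨m, n, rfl⟩ := mem_gaussLattice_iff.mp hz
  exact ⟨m, by simp⟩

/-- A Gaussian integer of norm `< 1` is `0`. [folklore] -/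
theorem eq_zero_of_mem_gaussLattice_of_norm_lt_one {z : ℂ} (hz : z ∈ gaussLattice)
    (h : ‖z‖ < 1) : z = 0 := by
  obtain ⟨m, n, rfl⟩ := mem_gaussLattice_iff.mp hz
  have h2 : ‖(m : ℂ) + n * Complex.I‖ ^ 2 = (m : ℝ) ^ 2 + (n : ℝ) ^ 2 := by
    rw [Complex.sq_norm, Complex.normSq_apply]
    simp
    ring
  have hlt : (m : ℝ) ^ 2 + (n : ℝ) ^ 2 < 1 := by
    rw [← h2]
    have h0 : 0 ≤ ‖(m : ℂ) + n * Complex.I‖ := norm_nonneg _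
    nlinarith
  have hm : m = 0 := by
    by_contra hm
    have h1 : (1 : ℝ) ≤ (m : ℝ) ^ 2 := by
      have : (1 : ℤ) ≤ m ^ 2 := by nlinarith [Int.one_le_abs hm, abs_mul_abs_self m, abs_nonneg m]
      exact_mod_cast this
    nlinarith [sq_nonneg (n : ℝ)]
  have hn : n = 0 := by
    by_contra hn
    have h1 : (1 : ℝ) ≤ (n : ℝ) ^ 2 := by
      have : (1 : ℤ) ≤ n ^ 2 := by nlinarith [Int.one_le_abs hn, abs_mul_abs_self n, abs_nonneg n]
      exact_mod_cast this
    nlinarith [sq_nonneg (m : ℝ)]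
  simp [hm, hn]

/-- The Gaussian lattice is closed in `ℂ` (a discrete subgroup). [folklore] -/
instance isClosed_gaussLattice : IsClosed ((gaussLattice.toAddSubgroup : AddSubgroup ℂ) : Set ℂ) :=
  AddSubgroup.isClosed_of_discrete

end TwistedTorus

/-- The **twisted torus**: as a topological space, the square torus `ℂ ⧸ (ℤ ⊕ ℤi)` (a type
synonym of the quotient group, which below receives a deliberately non-holomorphic smooth
atlas). [folklore] -/
def TwistedTorus : Type := ℂ ⧸ (TwistedTorus.gaussLattice.toAddSubgroup : AddSubgroup ℂ)

namespace TwistedTorus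

/-- The quotient topology. [folklore] -/
instance instTopologicalSpace : TopologicalSpace TwistedTorus :=
  inferInstanceAs (TopologicalSpace (ℂ ⧸ (gaussLattice.toAddSubgroup : AddSubgroup ℂ)))

/-- The torus is Hausdorff (quotient of a topological group by a closed subgroup). [folklore] -/
instance instT2Space : T2Space TwistedTorus :=
  inferInstanceAs (T2Space (ℂ ⧸ (gaussLattice.toAddSubgroup : AddSubgroup ℂ)))

/-- The projection `ℂ → ℂ ⧸ ℤ[i]`. [folklore] -/
def proj : ℂ → TwistedTorus :=
  (QuotientAddGroup.mk : ℂ → ℂ ⧸ (gaussLattice.toAddSubgroup : AddSubgroup ℂ))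

/-- Two points have the same image on the torus iff they differ by a Gaussian integer.
[folklore] -/
theorem proj_eq_proj_iff {z w : ℂ} : proj z = proj w ↔ w - z ∈ gaussLattice := by
  change (QuotientAddGroup.mk z : ℂ ⧸ (gaussLattice.toAddSubgroup : AddSubgroup ℂ)) =
    QuotientAddGroup.mk w ↔ _
  rw [QuotientAddGroup.eq, sub_eq_add_neg, add_comm w]
  rfl

/-- Translating by a Gaussian integer does not change the image on the torus. [folklore] -/
theorem proj_add_of_mem {z c : ℂ} (hc : c ∈ gaussLattice) : proj (z + c) = proj z :=
  (proj_eq_proj_iff.mpr (by simpa using Submodule.neg_mem _ hc))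

/-- The projection is surjective. [folklore] -/
theorem proj_surjective : Surjective proj :=
  QuotientAddGroup.mk_surjective

/-- The projection is continuous. [folklore] -/
theorem continuous_proj : Continuous proj :=
  QuotientAddGroup.continuous_mk

/-- The projection is a quotient covering map for the translation action of `ℤ[i]` (Mathlib:
quotients of commutative topological groups by discrete subgroups). [folklore] -/
theorem isAddQuotientCoveringMap_proj :
    IsAddQuotientCoveringMap proj (gaussLattice.toAddSubgroup : AddSubgroup ℂ) :=
  haveI : DiscreteTopology ((gaussLattice.toAddSubgroup : AddSubgroup ℂ) : Set ℂ) :=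
    inferInstanceAs (DiscreteTopology gaussLattice.toAddSubgroup)
  AddSubgroup.isAddQuotientCoveringMap_of_comm _ DiscreteTopology.isDiscrete

/-- The projection is a local homeomorphism. [folklore] -/
theorem isLocalHomeomorph_proj : IsLocalHomeomorph proj :=
  isAddQuotientCoveringMap_proj.isCoveringMap.isLocalHomeomorph

/-- The projection is an open map. [folklore] -/
theorem isOpenMap_proj : IsOpenMap proj :=
  isLocalHomeomorph_proj.isOpenMap

/-- Reduction to the fundamental square does not change the image on the torus. [folklore] -/
theorem proj_fract (z : ℂ) : proj (ZSpan.fract Complex.basisOneI z) = proj z := by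
  rw [proj_eq_proj_iff, ZSpan.fract_apply, sub_sub_cancel]
  exact SetLike.coe_mem _

/-- The torus is the image of the closed ball of radius `2` (which contains the fundamental
square). [folklore] -/
theorem proj_image_closedBall : proj '' Metric.closedBall (0 : ℂ) 2 = univ := by
  refine eq_univ_of_forall fun x ↦ ?_
  obtain ⟨z, rfl⟩ := proj_surjective x
  refine ⟨ZSpan.fract Complex.basisOneI z, ?_, proj_fract z⟩
  rw [Metric.mem_closedBall, dist_zero_right]
  refine (ZSpan.norm_fract_le Complex.basisOneI z).trans ?_
  simp [Fin.sum_univ_two, Complex.coe_basisOneI]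
  norm_num

/-- The torus is compact. [folklore] -/
instance instCompactSpace : CompactSpace TwistedTorus :=
  ⟨by rw [← proj_image_closedBall]; exact (isCompact_closedBall 0 2).image continuous_proj⟩

/-! ### Covering charts and straight charts -/

/-- A local homeomorphism `ℂ → TwistedTorus` around `z` that agrees with `proj` (from the
covering-map structure). [folklore] -/
def cov (z : ℂ) : OpenPartialHomeomorph ℂ TwistedTorus :=
  Classical.choose (isLocalHomeomorph_proj z)

/-- `z` lies in the source of `cov z`. [folklore] -/
theorem mem_cov_source (z : ℂ) : z ∈ (cov z).source :=
  (Classical.choose_spec (isLocalHomeomorph_proj z)).1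

/-- `cov z` is `proj` as a function. [folklore] -/
@[simp]
theorem coe_cov (z : ℂ) : ⇑(cov z) = proj :=
  (Classical.choose_spec (isLocalHomeomorph_proj z)).2.symm

/-- A chosen lift of a point of the torus. [folklore] -/
def lift (x : TwistedTorus) : ℂ :=
  Classical.choose (proj_surjective x)

/-- The chosen lift projects back to the point. [folklore] -/
@[simp]
theorem proj_lift (x : TwistedTorus) : proj (lift x) = x :=
  Classical.choose_spec (proj_surjective x)

/-- The **straight chart** at `x`: the local inverse of `proj` around the chosen lift of `x`.
[folklore] -/
def sChart (x : TwistedTorus) : OpenPartialHomeomorph TwistedTorus ℂ :=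
  (cov (lift x)).symm

/-- `x` lies in the source of its straight chart. [folklore] -/
theorem mem_sChart_source (x : TwistedTorus) : x ∈ (sChart x).source := by
  have h := (cov (lift x)).map_source (mem_cov_source (lift x))
  rw [coe_cov, proj_lift] at h
  exact h

/-- The inverse of a straight chart is `proj` (as a function, everywhere). [folklore] -/
@[simp]
theorem coe_sChart_symm (x : TwistedTorus) : ⇑(sChart x).symm = proj := by
  rw [sChart, OpenPartialHomeomorph.symm_symm, coe_cov]

/-- A straight chart is a right inverse of `proj` on its source: `proj (sChart x p) = p`.
[folklore] -/
theorem proj_sChart {x p : TwistedTorus} (hp : p ∈ (sChart x).source) : proj (sChart x p) = p := by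
  rw [← coe_sChart_symm x]
  exact (sChart x).left_inv hp

/-- The **lattice-translation lemma.** The map `y ↦ sChart x (proj y)` — a straight chart read
through the projection — differs from the identity by a Gaussian integer at every point of the
open set `proj ⁻¹' (sChart x).source`, and that Gaussian integer is locally constant: near any
such point `y₀` the map *is* the translation `y ↦ y + (sChart x (proj y₀) - y₀)`. (A continuous
map into the discrete set `ℤ[i]` is locally constant.) [folklore] -/
theorem sChart_proj_eventuallyEq_add (x : TwistedTorus) {y₀ : ℂ}
    (hy₀ : proj y₀ ∈ (sChart x).source) :
    (fun y ↦ sChart x (proj y)) =ᶠ[𝓝 y₀] fun y ↦ y + (sChart x (proj y₀) - y₀) := by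
  -- the difference `sChart x (proj y) - y` is a Gaussian integer on `proj ⁻¹' source`
  have hmem : ∀ y, proj y ∈ (sChart x).source → sChart x (proj y) - y ∈ gaussLattice := fun y hy ↦
    proj_eq_proj_iff.mp (proj_sChart hy).symm
  -- continuity of `y ↦ sChart x (proj y) - y` at `y₀`
  have hcont : ContinuousAt (fun y ↦ sChart x (proj y) - y) y₀ :=
    (((sChart x).continuousAt hy₀).comp continuous_proj.continuousAt).sub continuousAt_id
  have hopen : ∀ᶠ y in 𝓝 y₀, proj y ∈ (sChart x).source :=
    continuous_proj.continuousAt.preimage_mem_nhds ((sChart x).open_source.mem_nhds hy₀)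
  have hnear : ∀ᶠ y in 𝓝 y₀, dist (sChart x (proj y) - y) (sChart x (proj y₀) - y₀) < 1 :=
    (Metric.tendsto_nhds.mp hcont) 1 one_pos
  filter_upwards [hopen, hnear] with y hy hd
  have hsub : (sChart x (proj y) - y) - (sChart x (proj y₀) - y₀) ∈ gaussLattice :=
    Submodule.sub_mem _ (hmem y hy) (hmem y₀ hy₀)
  have h0 := eq_zero_of_mem_gaussLattice_of_norm_lt_one hsub (by rwa [← dist_eq_norm])
  linear_combination h0

/-! ### The twist -/

/-- The dense set `D = proj {z | Re z ∈ ℚ}` on which the charts are left holomorphic. [folklore] -/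
def D : Set TwistedTorus := proj '' {z : ℂ | z.re ∈ range ((↑) : ℚ → ℝ)}

/-- The preimage of `D` in `ℂ` is `{Re z ∈ ℚ}` (the lattice translates `Re` by integers).
[folklore] -/
theorem proj_preimage_D : proj ⁻¹' D = {z : ℂ | z.re ∈ range ((↑) : ℚ → ℝ)} := by
  ext z
  simp only [D, mem_preimage, mem_image, mem_setOf_eq, mem_range]
  constructor
  · rintro ⟨w, ⟨q, hq⟩, hw⟩
    obtain ⟨m, hm⟩ := exists_re_eq_intCast_of_mem_gaussLattice (proj_eq_proj_iff.mp hw)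
    refine ⟨q + m, ?_⟩
    have : z.re = w.re + (z - w).re := by simp
    rw [this, hm, ← hq]
    push_cast
    ring
  · rintro ⟨q, hq⟩
    exact ⟨z, ⟨q, hq⟩, rfl⟩

/-- Membership of `proj z` in `D` is rationality of `Re z`. [folklore] -/
theorem proj_mem_D_iff {z : ℂ} : proj z ∈ D ↔ z.re ∈ range ((↑) : ℚ → ℝ) := by
  rw [← mem_preimage, proj_preimage_D, mem_setOf_eq]

/-- `{Re z ∈ ℚ}` is dense in `ℂ`. [folklore] -/
theorem dense_re_mem_range_ratCast : Dense {z : ℂ | z.re ∈ range ((↑) : ℚ → ℝ)} :=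
  Rat.denseRange_cast.preimage Complex.isOpenMap_re

/-- `{Re z ∉ ℚ}` is dense in `ℂ`. [folklore] -/
theorem dense_re_not_mem_range_ratCast : Dense {z : ℂ | z.re ∉ range ((↑) : ℚ → ℝ)} :=
  dense_irrational.preimage Complex.isOpenMap_re

open scoped Classical in
/-- The **twist** at `x`: the identity of `ℂ` if `x ∈ D`, complex conjugation otherwise (as real
continuous linear automorphisms). [folklore] -/
def twist (x : TwistedTorus) : ℂ ≃L[ℝ] ℂ :=
  if x ∈ D then ContinuousLinearEquiv.refl ℝ ℂ else Complex.conjCLE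

/-- The twist is the identity on `D`. [folklore] -/
theorem twist_of_mem {x : TwistedTorus} (hx : x ∈ D) : twist x = ContinuousLinearEquiv.refl ℝ ℂ := by
  simp [twist, hx]

/-- The twist is conjugation off `D`. [folklore] -/
theorem twist_of_not_mem {x : TwistedTorus} (hx : x ∉ D) : twist x = Complex.conjCLE := by
  simp [twist, hx]

/-- The twist is the identity or conjugation. [folklore] -/
theorem twist_eq_or (x : TwistedTorus) :
    twist x = ContinuousLinearEquiv.refl ℝ ℂ ∨ twist x = Complex.conjCLE := by
  by_cases hx : x ∈ D
  · exact Or.inl (twist_of_mem hx)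
  · exact Or.inr (twist_of_not_mem hx)

/-- The twist is an involution: `(twist x).symm = twist x`. [folklore] -/
@[simp]
theorem twist_symm (x : TwistedTorus) : (twist x).symm = twist x := by
  rcases twist_eq_or x with h | h <;> rw [h] <;> rfl

/-- The twist preserves real parts. [folklore] -/
@[simp]
theorem re_twist (x : TwistedTorus) (z : ℂ) : (twist x z).re = z.re := by
  rcases twist_eq_or x with h | h <;> simp [h]

/-- The **twisted chart** at `x`: the straight chart followed by the twist. [folklore] -/
def tChart (x : TwistedTorus) : OpenPartialHomeomorph TwistedTorus ℂ :=
  (sChart x).transHomeomorph (twist x).toHomeomorph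

/-- The twisted chart as a function. [folklore] -/
@[simp]
theorem coe_tChart (x : TwistedTorus) : ⇑(tChart x) = twist x ∘ sChart x := rfl

/-- The inverse of the twisted chart as a function: `proj ∘ twist x`. [folklore] -/
@[simp]
theorem coe_tChart_symm (x : TwistedTorus) : ⇑(tChart x).symm = proj ∘ twist x := by
  rw [tChart, OpenPartialHomeomorph.transHomeomorph_symm_apply, coe_sChart_symm,
    ContinuousLinearEquiv.coe_symm_toHomeomorph, twist_symm]

/-- The source of the twisted chart is that of the straight chart. [folklore] -/
@[simp]
theorem tChart_source (x : TwistedTorus) : (tChart x).source = (sChart x).source := rfl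

/-- **The twisted charted-space structure on the torus**: the atlas of all `sChart x` and all
`conj ∘ sChart x`, with preferred chart `tChart x` (straight on `D`, conjugated off `D`).
[folklore] -/
instance instChartedSpace : ChartedSpace ℂ TwistedTorus where
  atlas := {e | ∃ x : TwistedTorus, ∃ σ : ℂ ≃L[ℝ] ℂ,
    (σ = ContinuousLinearEquiv.refl ℝ ℂ ∨ σ = Complex.conjCLE) ∧
      e = (sChart x).transHomeomorph σ.toHomeomorph}
  chartAt := tChart
  mem_chart_source x := mem_sChart_source x
  chart_mem_atlas x := ⟨x, twist x, twist_eq_or x, rfl⟩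

/-- The preferred chart is the twisted chart. [folklore] -/
@[simp]
theorem chartAt_eq (x : TwistedTorus) : chartAt ℂ x = tChart x := rfl

/-- **Transition maps of the twisted atlas are locally affine.** For charts
`e = σ ∘ sChart x`, `e' = σ' ∘ sChart x'` of the atlas and a point `y₀` of the source of
`e.symm ≫ₕ e'`, the transition map is, near `y₀`, `y ↦ σ' (σ⁻¹ y + c)` for a Gaussian integer
`c`. [folklore] -/
theorem transition_eventuallyEq (x x' : TwistedTorus) (σ σ' : ℂ ≃L[ℝ] ℂ) {y₀ : ℂ}
    (hy₀ : y₀ ∈ (((sChart x).transHomeomorph σ.toHomeomorph).symm ≫ₕ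
      (sChart x').transHomeomorph σ'.toHomeomorph).source) :
    ∃ c : ℂ, c ∈ gaussLattice ∧
      (((sChart x).transHomeomorph σ.toHomeomorph).symm ≫ₕ
          (sChart x').transHomeomorph σ'.toHomeomorph : ℂ → ℂ) =ᶠ[𝓝 y₀]
        fun y ↦ σ' (σ.symm y + c) := by
  have hsrc : proj (σ.symm y₀) ∈ (sChart x').source := by
    have h := hy₀
    simp only [OpenPartialHomeomorph.trans_source, OpenPartialHomeomorph.symm_source,
      mem_inter_iff, mem_preimage, OpenPartialHomeomorph.transHomeomorph_symm_apply,
      OpenPartialHomeomorph.transHomeomorph_source, coe_sChart_symm, comp_apply,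
      ContinuousLinearEquiv.coe_symm_toHomeomorph] at h
    exact h.2
  refine ⟨sChart x' (proj (σ.symm y₀)) - σ.symm y₀,
    proj_eq_proj_iff.mp (proj_sChart hsrc).symm, ?_⟩
  have hev := (sChart_proj_eventuallyEq_add x' hsrc).comp_tendsto
    (σ.symm.continuous.continuousAt (x := y₀))
  filter_upwards [hev] with y hy
  simp only [comp_apply] at hy
  simp only [OpenPartialHomeomorph.coe_trans, OpenPartialHomeomorph.transHomeomorph_apply,
    OpenPartialHomeomorph.transHomeomorph_symm_apply, coe_sChart_symm, comp_apply,
    ContinuousLinearEquiv.coe_toHomeomorph, ContinuousLinearEquiv.coe_symm_toHomeomorph]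
  rw [hy]

/-- **The twisted torus is a `C^n` real manifold over `ℂ` for every `n`** (including `ω`): its
transition maps are locally `y ↦ σ' (σ⁻¹ y + c)` with `σ, σ' ∈ {id, conj}` real-linear.
It is *not* a complex manifold. [folklore] -/
instance instIsManifold (n : WithTop ℕ∞) : IsManifold 𝓘(ℝ, ℂ) n TwistedTorus := by
  refine isManifold_of_contDiffOn _ _ _ fun e e' he he' ↦ ?_
  obtain ⟨x, σ, -, rfl⟩ := he
  obtain ⟨x', σ', -, rfl⟩ := he'
  simp only [modelWithCornersSelf_coe, modelWithCornersSelf_coe_symm, comp_id, id_comp,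
    range_id, preimage_id_eq, id_eq, inter_univ]
  intro y₀ hy₀
  obtain ⟨c, -, hc⟩ := transition_eventuallyEq x x' σ σ' hy₀
  have hsmooth : ContDiffAt ℝ n (fun y ↦ σ' (σ.symm y + c)) y₀ :=
    (σ'.contDiff.comp ((σ.symm.contDiff.add contDiff_const))).contDiffAt
  exact (hsmooth.congr_of_eventuallyEq hc).contDiffWithinAt

/-! ### Tangent coordinate changes are `id` or `conj` -/

/-- The extended chart of the twisted torus is the twisted chart (the model is `𝓘(ℝ, ℂ)`).
[folklore] -/
theorem extChartAt_coe (x : TwistedTorus) : ⇑(extChartAt 𝓘(ℝ, ℂ) x) = tChart x := by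
  rw [_root_.extChartAt_coe, modelWithCornersSelf_coe, id_comp, chartAt_eq]

/-- The inverse extended chart is `proj ∘ twist x`. [folklore] -/
theorem extChartAt_coe_symm (x : TwistedTorus) : ⇑(extChartAt 𝓘(ℝ, ℂ) x).symm = proj ∘ twist x := by
  rw [_root_.extChartAt_coe_symm, modelWithCornersSelf_coe_symm, chartAt_eq, coe_tChart_symm]
  rfl

/-- **The derivative of a transition map of the twisted atlas** at a point of the chart domain:
`D(φ_x ∘ φ_{x₀}⁻¹)(φ_{x₀} x) = twist x ∘ twist x₀` (each twist is `id` or `conj`, an involution).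
[folklore] -/
theorem fderivWithin_transition {x₀ x : TwistedTorus} (hx : x ∈ (chartAt ℂ x₀).source) :
    fderivWithin ℝ (extChartAt 𝓘(ℝ, ℂ) x ∘ (extChartAt 𝓘(ℝ, ℂ) x₀).symm) (range 𝓘(ℝ, ℂ))
        (extChartAt 𝓘(ℝ, ℂ) x₀ x) =
      (twist x : ℂ →L[ℝ] ℂ) ∘L (twist x₀ : ℂ →L[ℝ] ℂ) := by
  rw [modelWithCornersSelf_coe, range_id, fderivWithin_univ, extChartAt_coe, extChartAt_coe,
    _root_.extChartAt_coe_symm, modelWithCornersSelf_coe_symm, chartAt_eq]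
  rw [chartAt_eq] at hx
  have hy₀ : tChart x₀ x ∈ ((tChart x₀).symm ≫ₕ tChart x).source := by
    simp only [OpenPartialHomeomorph.trans_source, OpenPartialHomeomorph.symm_source, mem_inter_iff,
      mem_preimage, (tChart x₀).map_source hx, (tChart x₀).left_inv hx, true_and]
    exact mem_sChart_source x
  obtain ⟨c, -, hc⟩ := transition_eventuallyEq x₀ x (twist x₀) (twist x) hy₀
  simp only [twist_symm] at hc
  have hderiv : HasFDerivAt (fun y ↦ twist x (twist x₀ y + c))
      ((twist x : ℂ →L[ℝ] ℂ) ∘L (twist x₀ : ℂ →L[ℝ] ℂ)) (tChart x₀ x) :=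
    ((twist x).hasFDerivAt).comp (tChart x₀ x) (((twist x₀).hasFDerivAt).add_const c)
  have hc' : ((tChart x₀).symm ≫ₕ tChart x : ℂ → ℂ) =ᶠ[𝓝 (tChart x₀ x)]
      fun y ↦ twist x (twist x₀ y + c) := hc
  have heq : (tChart x ∘ (tChart x₀).symm ∘ id) = ((tChart x₀).symm ≫ₕ tChart x : ℂ → ℂ) := rfl
  rw [heq, hc'.fderiv_eq]
  exact hderiv.fderiv

/-- **Tangent coordinate changes of the twisted torus are `twist x ∘ twist x₀ ∈ {id, conj}`.**
[folklore] -/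
theorem tangentCoordChange_eq {x₀ x : TwistedTorus} (hx : x ∈ (chartAt ℂ x₀).source) :
    tangentCoordChange 𝓘(ℝ, ℂ) x₀ x x = (twist x : ℂ →L[ℝ] ℂ) ∘L (twist x₀ : ℂ →L[ℝ] ℂ) := by
  rw [tangentCoordChange_def, fderivWithin_transition hx]

/-- The coordinate change of the tangent bundle core, in the same situation. [folklore] -/
theorem coordChange_eq {x₀ x : TwistedTorus} (hx : x ∈ (chartAt ℂ x₀).source) :
    (tangentBundleCore 𝓘(ℝ, ℂ) TwistedTorus).coordChange (achart ℂ x₀) (achart ℂ x) x =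
      (twist x : ℂ →L[ℝ] ℂ) ∘L (twist x₀ : ℂ →L[ℝ] ℂ) := by
  rw [tangentBundleCore_coordChange_achart, fderivWithin_transition hx]

/-! ### The flat metric -/

/-- The standard real inner product of `ℂ = ℝ²` as a continuous bilinear form. [folklore] -/
abbrev B₀ : ℂ →L[ℝ] ℂ →L[ℝ] ℝ := innerSL ℝ (E := ℂ)

/-- The standard inner product of `ℂ` is invariant under each twist (`id` or `conj`). [folklore] -/
theorem B₀_twist (x : TwistedTorus) (v w : ℂ) : B₀ (twist x v) (twist x w) = B₀ v w := by
  rcases twist_eq_or x with h | h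
  · simp [h]
  · rw [h]
    exact Complex.conjLIE.inner_map_map v w

set_option backward.isDefEq.respectTransparency false in
/-- **The constant section `x ↦ ⟪·, ·⟫` of the bundle of bilinear forms on the tangent bundle of the
twisted torus is smooth**: in the trivialisation at `x₀` it reads
`x ↦ ⟪(twist x ∘ twist x₀) ·, (twist x ∘ twist x₀) ·⟫ = ⟪·, ·⟫`, a constant. [folklore] -/
theorem contMDiff_B₀ :
    ContMDiff 𝓘(ℝ, ℂ) (𝓘(ℝ, ℂ).prod 𝓘(ℝ, ℂ →L[ℝ] ℂ →L[ℝ] ℝ)) ∞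
      (fun b : TwistedTorus ↦ TotalSpace.mk' (ℂ →L[ℝ] ℂ →L[ℝ] ℝ)
        (E := fun x : TwistedTorus ↦
          TangentSpace 𝓘(ℝ, ℂ) x →L[ℝ] TangentSpace 𝓘(ℝ, ℂ) x →L[ℝ] ℝ) b B₀) := by
  intro b₀
  rw [contMDiffAt_section]
  refine (contMDiffAt_const (c := (B₀ : ℂ →L[ℝ] ℂ →L[ℝ] ℝ))).congr_of_eventuallyEq ?_
  filter_upwards [(chartAt ℂ b₀).open_source.mem_nhds (mem_chart_source ℂ b₀)] with b hb
  rw [hom_trivializationAt_apply]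
  dsimp only
  ext v w
  have hb' : b ∈ (trivializationAt (ℂ →L[ℝ] ℝ)
      (fun x : TwistedTorus ↦ TangentSpace 𝓘(ℝ, ℂ) x →L[ℝ] ℝ) b₀).baseSet := by
    simpa using hb
  rw [ContinuousLinearMap.inCoordinates, ContinuousLinearMap.comp_apply,
    ContinuousLinearMap.comp_apply, Trivialization.continuousLinearMapAt_apply_of_mem ℝ _ hb',
    hom_trivializationAt_apply]
  dsimp only
  rw [ContinuousLinearMap.inCoordinates, ContinuousLinearMap.comp_apply,
    ContinuousLinearMap.comp_apply, TangentBundle.symmL_trivializationAt_eq_core hb, coordChange_eq hb]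
  simp only [Trivial.fiberBundle_trivializationAt', Trivial.linearMapAt_trivialization,
    Trivialization.continuousLinearMapAt_apply, LinearMap.id_coe, id_eq]
  change B₀ (twist b (twist b₀ v)) (twist b (twist b₀ w)) = B₀ v w
  rw [B₀_twist, B₀_twist]

/-- **The flat metric of the twisted torus** as a smooth Riemannian metric on its (twisted)
tangent bundle: the standard inner product of `ℂ` on every tangent space (the flat metric of the
torus; it is the same bilinear form in straight and in conjugated charts, `conj` being an
isometry). [folklore] -/
def flatMetric :
    ContMDiffRiemannianMetric 𝓘(ℝ, ℂ) ∞ ℂ (fun x : TwistedTorus ↦ TangentSpace 𝓘(ℝ, ℂ) x) where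
  inner _ := B₀
  symm _ := (riemannianMetricVectorSpace ℂ).symm 0
  pos _ := (riemannianMetricVectorSpace ℂ).pos 0
  isVonNBounded _ := (riemannianMetricVectorSpace ℂ).isVonNBounded 0
  contMDiff := contMDiff_B₀

/-- The flat metric at `x` is the standard inner product (definitional). [folklore] -/
@[simp]
theorem flatMetric_inner (x : TwistedTorus) : flatMetric.inner x = B₀ := rfl

set_option backward.isDefEq.respectTransparency false in
/-- **The flat metric is Hermitian** for the would-be complex structure `J = i •` of the tangent
spaces (multiplication by `i` is a real isometry of `ℂ`). [folklore] -/
theorem isHermitian_flatMetric : flatMetric.toRiemannianMetric.IsHermitian := by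
  intro x v w
  change inner ℝ (Complex.I * (show ℂ from v)) (Complex.I * (show ℂ from w)) =
    inner ℝ (show ℂ from v) (show ℂ from w)
  rw [Complex.inner, Complex.inner]
  simp only [map_mul, Complex.conj_I]
  ring_nf
  rw [Complex.I_sq]
  ring_nf

/-- The flat metric as a `RiemannianBundle` structure on the twisted tangent bundle: a reducible
`def` used as a *local* instance (exactly the `letI` of the facts under refutation), never a
global instance. [folklore] -/
@[reducible]
def bundle : RiemannianBundle (fun x : TwistedTorus ↦ TangentSpace 𝓘(ℝ, ℂ) x) :=
  ⟨flatMetric.toRiemannianMetric⟩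

/-! ### Orientation and volume form -/

/-- The basis `(1, i)` of a tangent space of the twisted torus (`TangentSpace 𝓘(ℝ, ℂ) x = ℂ`).
[folklore] -/
def basisT (x : TwistedTorus) : Basis (Fin 2) ℝ (TangentSpace 𝓘(ℝ, ℂ) x) := Complex.basisOneI

/-- `basisT x = ![1, i]`. [folklore] -/
theorem coe_basisT (x : TwistedTorus) : ⇑(basisT x) = ![(1 : ℂ), Complex.I] :=
  Complex.coe_basisOneI

open scoped Classical in
/-- The sign `ε(x)`: `+1` on `D`, `-1` off `D` (the determinant of `twist x`). [folklore] -/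
def sgn (x : TwistedTorus) : ℝ := if x ∈ D then 1 else -1

/-- `ε(x)² = 1`. [folklore] -/
theorem sgn_mul_self (x : TwistedTorus) : sgn x * sgn x = 1 := by
  unfold sgn; split_ifs <;> norm_num

/-- **`det (twist x) = ε(x)`** (`det id = 1`, `det conj = -1`). [folklore] -/
theorem det_twist (x : TwistedTorus) :
    LinearMap.det ((twist x : ℂ →L[ℝ] ℂ) : ℂ →ₗ[ℝ] ℂ) = sgn x := by
  by_cases hx : x ∈ D
  · rw [twist_of_mem hx, sgn, if_pos hx]
    exact LinearMap.det_id
  · rw [twist_of_not_mem hx, sgn, if_neg hx]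
    exact Complex.det_conjLIE

open scoped Classical in
/-- **The orientation family of the twisted torus**: the standard orientation `(1, i)` of
`TangentSpace 𝓘(ℝ, ℂ) x = ℂ` for `x ∈ D` and its opposite for `x ∉ D` — i.e. the *constant*
geometric orientation of the torus read through the twisted charts (conjugation reverses
orientation). [folklore] -/
def orient (x : TwistedTorus) : Orientation ℝ (TangentSpace 𝓘(ℝ, ℂ) x) (Fin 2) :=
  if x ∈ D then (basisT x).orientation else -(basisT x).orientation

/-- The basis `(1, -i)` (positively oriented for `orient x` when `x ∉ D`). [folklore] -/
def basisT' (x : TwistedTorus) : Basis (Fin 2) ℝ (TangentSpace 𝓘(ℝ, ℂ) x) :=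
  (basisT x).unitsSMul ![1, -1]

/-- `(1, -i)` has the opposite orientation of `(1, i)`. [folklore] -/
theorem orientation_basisT' (x : TwistedTorus) : (basisT' x).orientation = -(basisT x).orientation := by
  rw [basisT', Basis.orientation_unitsSMul]
  have h : (∏ i, (![1, -1] : Fin 2 → ℝˣ) i)⁻¹ = -1 := by simp [Fin.prod_univ_two]
  rw [h]
  exact Module.Ray.units_smul_of_neg _ (by simp) _

/-- The determinant form of `(1, -i)` is minus that of `(1, i)`. [folklore] -/
theorem det_basisT' (x : TwistedTorus) : (basisT' x).det = -(basisT x).det := by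
  rw [basisT', Basis.det_unitsSMul]
  ext v
  simp [Fin.prod_univ_two]

section WithMetric

attribute [local instance] bundle

set_option backward.isDefEq.respectTransparency false in
/-- The inner product of the flat metric on `T_x = ℂ` is the standard one, in coordinates.
[folklore] -/
theorem inner_eq (x : TwistedTorus) (u v : TangentSpace 𝓘(ℝ, ℂ) x) :
    inner ℝ u v = Complex.re u * Complex.re v + Complex.im u * Complex.im v := by
  change inner ℝ (show ℂ from u) (show ℂ from v) = _
  rw [Complex.inner, Complex.mul_re, Complex.conj_re, Complex.conj_im]
  ring

/-- `(1, i)` is orthonormal for the flat metric. [folklore] -/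
theorem orthonormal_basisT (x : TwistedTorus) : Orthonormal ℝ (basisT x) := by
  rw [orthonormal_iff_ite]
  intro i j
  rw [inner_eq]
  fin_cases i <;> fin_cases j <;> simp [coe_basisT]

/-- `(1, -i)` is orthonormal for the flat metric. [folklore] -/
theorem orthonormal_basisT' (x : TwistedTorus) : Orthonormal ℝ (basisT' x) :=
  (orthonormal_basisT x).orthonormal_of_forall_eq_or_eq_neg fun i ↦ by
    fin_cases i
    · exact Or.inl (by simp [basisT', Basis.unitsSMul_apply])
    · exact Or.inr (by simp [basisT', Basis.unitsSMul_apply, Units.smul_def])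

/-- `(1, i)` as an orthonormal basis of `T_x`. [folklore] -/
def onbT (x : TwistedTorus) : OrthonormalBasis (Fin 2) ℝ (TangentSpace 𝓘(ℝ, ℂ) x) :=
  (basisT x).toOrthonormalBasis (orthonormal_basisT x)

/-- `(1, -i)` as an orthonormal basis of `T_x`. [folklore] -/
def onbT' (x : TwistedTorus) : OrthonormalBasis (Fin 2) ℝ (TangentSpace 𝓘(ℝ, ℂ) x) :=
  (basisT' x).toOrthonormalBasis (orthonormal_basisT' x)

/-- **The volume form of the flat metric for the orientation family**: `vol_x = ε(x) · det_{(1,i)}`.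
[folklore] -/
theorem volumeForm_orient (x : TwistedTorus) (v : Fin 2 → TangentSpace 𝓘(ℝ, ℂ) x) :
    (orient x).volumeForm v = sgn x * (basisT x).det v := by
  by_cases hx : x ∈ D
  · have hb : (onbT x).toBasis.orientation = orient x := by
      rw [onbT, Basis.toBasis_toOrthonormalBasis, orient, if_pos hx]
    rw [Orientation.volumeForm_robust _ _ hb, onbT, Basis.toBasis_toOrthonormalBasis, sgn, if_pos hx,
      one_mul]
  · have hb : (onbT' x).toBasis.orientation = orient x := by
      rw [onbT', Basis.toBasis_toOrthonormalBasis, orient, if_neg hx, orientation_basisT']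
    rw [Orientation.volumeForm_robust _ _ hb, onbT', Basis.toBasis_toOrthonormalBasis, det_basisT', sgn,
      if_neg hx, AlternatingMap.neg_apply, neg_one_mul]

/-- The Riemannian volume form of the flat metric evaluates as `ε(x) · det_{(1,i)}`. [folklore] -/
theorem riemannianVolumeForm_apply (x : TwistedTorus) (v : Fin 2 → TangentSpace 𝓘(ℝ, ℂ) x) :
    Literature.Geometry.Kaehler.riemannianVolumeForm orient x v = sgn x * (basisT x).det v := by
  rw [Literature.Geometry.Kaehler.riemannianVolumeForm_apply, Orientation.volumeFormL_apply,
    volumeForm_orient]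

/-- The determinant form `det_{(1,i)}` does not see the base point (all tangent spaces are `ℂ`):
it is `Complex.basisOneI.det`. [folklore] -/
theorem basisT_det_apply (x : TwistedTorus) (v : Fin 2 → ℂ) :
    (basisT x).det v = Complex.basisOneI.det v :=
  rfl

/-- Pulling `det_{(1,i)}` back along a twist multiplies it by `ε`. [folklore] -/
theorem basisOneI_det_comp_twist (x : TwistedTorus) (v : Fin 2 → ℂ) :
    Complex.basisOneI.det (fun i ↦ twist x (v i)) = sgn x * Complex.basisOneI.det v := by
  have h := Complex.basisOneI.det_comp ((twist x : ℂ →L[ℝ] ℂ) : ℂ →ₗ[ℝ] ℂ) v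
  rw [det_twist] at h
  exact h

/-- **The chart representative of the volume form is constant on each chart**: at a point `y` of
the target of the chart at `x₀` it is `ε(x₀) · det_{(1,i)}` (the two twists contribute
`ε(z)² ε(x₀)`… precisely `ε(z) · ε(z) ε(x₀)`). [folklore] -/
theorem inChart_riemannianVolumeForm_apply {x₀ : TwistedTorus} {y : ℂ}
    (hy : y ∈ (extChartAt 𝓘(ℝ, ℂ) x₀).target) (v : Fin 2 → ℂ) :
    (Literature.Geometry.Kaehler.riemannianVolumeForm orient).inChart x₀ y v =
      sgn x₀ * (basisT x₀).det v := by
  have hz : (extChartAt 𝓘(ℝ, ℂ) x₀).symm y ∈ (chartAt ℂ x₀).source := by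
    rw [← extChartAt_source 𝓘(ℝ, ℂ)]; exact (extChartAt 𝓘(ℝ, ℂ) x₀).map_target hy
  rw [Literature.Geometry.Kaehler.MForm.inChart_eq_of_mem_target _ hy,
    ContinuousAlternatingMap.compContinuousLinearMap_apply, tangentCoordChange_eq hz,
    riemannianVolumeForm_apply]
  set z := (extChartAt 𝓘(ℝ, ℂ) x₀).symm y
  change sgn z * Complex.basisOneI.det (fun i ↦ twist z (twist x₀ (v i))) =
    sgn x₀ * Complex.basisOneI.det v
  rw [basisOneI_det_comp_twist, basisOneI_det_comp_twist, ← mul_assoc, ← mul_assoc, sgn_mul_self,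
    one_mul]

/-- **The volume form of the twisted torus is smooth** (its chart representatives are constant):
the hypothesis `ho` of the facts under refutation holds for `orient`. [folklore] -/
theorem isSmoothForm_riemannianVolumeForm :
    Literature.Geometry.Kaehler.IsSmoothForm (Literature.Geometry.Kaehler.riemannianVolumeForm orient) := by
  intro x₀
  have hy₀ : extChartAt 𝓘(ℝ, ℂ) x₀ x₀ ∈ (extChartAt 𝓘(ℝ, ℂ) x₀).target := mem_extChartAt_target x₀
  have hev : (Literature.Geometry.Kaehler.riemannianVolumeForm orient).inChart x₀ =ᶠ[𝓝[range 𝓘(ℝ, ℂ)]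
      (extChartAt 𝓘(ℝ, ℂ) x₀ x₀)]
      fun _ ↦ (Literature.Geometry.Kaehler.riemannianVolumeForm orient).inChart x₀
        (extChartAt 𝓘(ℝ, ℂ) x₀ x₀) := by
    filter_upwards [extChartAt_target_mem_nhdsWithin (I := 𝓘(ℝ, ℂ)) x₀] with y hy
    ext v
    rw [inChart_riemannianVolumeForm_apply hy, inChart_riemannianVolumeForm_apply hy₀]
  exact contDiffWithinAt_const.congr_of_eventuallyEq hev rfl

end WithMetric

end TwistedTorus

end Literature.NumberTheory.Transcendental
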